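import Summits.ABC.ABC.Theses.IneffectiveSubspace
import Literature.NumberTheory.DiophantineGeometry.AbcDepthCensusTurboSym

/-!
# `DeepRegimeABC` (stmt-ABC-15121): certified census — the cell `ω₅ ≥ 9` does not meet `c ≤ 10¹⁹`, chunk run (I)

Compute-certificate (line lead `prover-line-stmt-ABC-15121-c3-0`, 2026-08-16; human certificate
objective) for the crux `Summit.ABC.ABC.Theses.IneffectiveSubspace.DeepRegimeABC` (abc with exponent
`1 + ε` on the deep tail `{ω₅(abc) ≥ K(ε)}`, `ω₅(n) := #{p : p⁵ ∣ n}`), with the symmetric turbo checker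
`Literature.NumberTheory.DiophantineGeometry.DepthCensus.checkTurboChunkSym` (`AbcDepthCensusTurboSym.lean`:
min-member cut, fused threshold-table walk, run-time-validated CRT unit, patterns with `A ≤ B` only;
`depth_lt_of_checkTurboChunksSym`).  Sharpens `…CensusCellNine18E.lean` (the cell `ω₅ ≥ 9` does not meet
`c ≤ 10¹⁸`) by one more decade.

**The certificate these runs serve** (assembled in `…CensusCellNine19J.lean`, registered stub
`censusCellNine19`): **the cell `{ω₅ ≥ 9}` contains no abc triple with `c ≤ 10¹⁹`** — not even a lattice
candidate of any depth pattern of nine primes (`6310⁵ > 10¹⁹`).  The box has `162 053 310` depth patterns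
(`2.7·10⁸` tree nodes after the min-member cut, `1.65·10⁹` outer steps) — eight times the `10¹⁸` box; the
cover is the 13-chunk cover `S₁₃` of depth 2 (`coversAll_S8`), one big chunk per file (A–I: `[1,1]`, `[1,2]`,
`[1,3]`, `[2,1]`, `[2,2]`, `[2,3]`, `[3,1]`, `[3,2]`, `[3,3]`, `1.64–1.68·10⁷` patterns, ≈ 300 s of farm time
each; measured `[1,1]`: 296 s) and the four small ones with the assembly in J.

**Certified here** (file I): the chunk below has no lattice candidate at all.  The only computation trusted
to the compiler is this closed `Bool` equation (`native_decide`, computational certificate lane).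
-/

-- `Summit.<Summit>.<Problem>` is the mandated summit-side namespace (CONVENTIONS §2); for the
-- single-conjunct summit `ABC` the two coincide, so the duplicate `ABC.ABC` is deliberate.
set_option linter.dupNamespace false

namespace Summit.ABC.ABC.Theorems.DeepRegimeABC

open Literature.NumberTheory.DiophantineGeometry
open Literature.NumberTheory.DiophantineGeometry.DepthCensus

/-! ## The compiled chunk run of this file -/

/-- Chunk `[3, 3]` of the cell `ω₅ ≥ 9` in the box `c ≤ 10¹⁹` (16 411 514 patterns, 171 922 826 outer steps): no lattice
candidate — **registered run stub `censusCellNine19RunsI`** (crux `DeepRegimeABC`, line SketchIdeator5R2),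
consumed by `…CensusCellNine19J.lean`. [folklore] -/
theorem censusCellNine19RunsI : Literature.NumberTheory.DiophantineGeometry.DepthCensus.checkTurboChunkSym (10 ^ 19) 6309 9 [3, 3] (fun _ _ _ => false) = true := by
  native_decide

end Summit.ABC.ABC.Theorems.DeepRegimeABC
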